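import Summits.AtomisticToContinuum.FouriersLaw.Theses.ParabolicBathMap

/-!
# Birth skeleton (`Lines/birth.lean`) for crux `ParabolicGerm` (stmt-AtomisticToContinuum-11921)

Route `ParabolicBathMap` (sub-problem `FouriersLaw`). The crux, verbatim: for `P = pinnedChain ω₂ lam β γ`
(all four `> 0`), ASSUMING weak-NESS uniqueness, for every `T > 0` there is ONE real `r` such that along EVERY
steady-state family `μ` and for EVERY conductance sequence `G` (`totalCurrent(μ N (T+δ/2) (T-δ/2))/((N-1)δ) → G N`
as `δ → 0`, `δ ≠ 0`, `N ≥ 2`): IF `G N → 0` (Recurrence) and `G N > 0` for `N ≥ 2` (OhmicSign) THEN the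
RESISTANCE INCREMENTS converge, `(G (N+1))⁻¹ - (G N)⁻¹ → r` (the bath map has a parabolic germ at the closed
environment along its orbit; `R_N := (G N)⁻¹` is the resistance of the `N`-chain).

## The line: TAUBERIAN SPLIT — resistance slope (Cesàro level) + slow oscillation of the increments (two stubs)

`R_N/N` is, up to the vanishing term `R_0/N`, the Cesàro mean of the increments `Δ_i := R_{i+1} - R_i`
(telescoping). Convergence of a real sequence is EQUIVALENT to (Cesàro convergence) ∧ (slow oscillation) —
R. Schmidt's Tauberian theorem — so the crux factors through one honest seam into two strictly weaker pieces
that fail for DIFFERENT physical reasons and are attacked by DIFFERENT tools: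

* `stub_resistanceSlope` — THE ORBIT HAS AN ASYMPTOTIC RESISTANCE PER SITE: under the crux's hypotheses,
  `R_N/N = (G N)⁻¹/N → r` for one real `r` (necessarily `r ≥ 0`; `r > 0` is Fourier's law with `κ = 1/r`,
  `r = 0` is the anomalous type WITH a rate, which this stub deliberately does not exclude — positivity is the
  sibling crux `ResistanceQuantum`). What it excludes: `liminf ≠ limsup` of `R_N/N` (the chain wandering between
  transport regimes on ever longer length scales). Tool: quasi-sub/superadditivity of `N ↦ R_N` under series
  composition + Fekete (the shared import slot `FeketeSeriesLaw.PositiveOrInfiniteLimit`, stmt-9128: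
  `D_N → ℓ ∈ (0,+∞]` in `EReal`, implies it by `EReal` bookkeeping and uniqueness of conductances), or ANY proof
  of the conjunct. A CONSEQUENCE of `FouriersLaw` (used toward it only through this crux), strictly weaker than it.
* `stub_slowOscillation` — GEOMETRIC-WINDOW SCREENING OF THE INSERTION RESISTANCE: under the same hypotheses the
  increment sequence `Δ_N` is SLOWLY OSCILLATING: for every `ε > 0` there are `θ > 0` and `N₀` with
  `|Δ_m - Δ_n| ≤ ε` whenever `N₀ ≤ n ≤ m ≤ (1+θ) n` — lengthening an already long chain by a bounded FRACTION
  changes the cost of one more site by at most `ε`. This is where the route's thesis (locality of the insertion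
  resistance, `JunctionLocality`, which gives the much stronger Cauchy property) must deliver, in its weakest
  useful form; it tolerates slowly DIVERGING increments (`Δ_N ~ log N` is slowly oscillating) and every power-law
  finite-size correction, and it is killed exactly by the crux's named failure mode: a persistent `O(1)`
  oscillation of `Δ_N` on a length scale `o(N)` (period-2 band-edge / contact resonances surviving at `T > 0`).
* `ParabolicGerm_of` — the composition, kernel-checked here (no `sorry`): `r` from stub 1 (its `∃ r ∀ family`
  is the crux's); for a family and a conductance sequence satisfying the antecedents, telescoping
  (`Finset.sum_range_sub`) turns `R_N/N → r` into Cesàro convergence of `Δ`, and the discrete Schmidt Tauberian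
  theorem `tendsto_of_cesaro_of_slowlyOscillating` (PROVED below, window argument `m = n + ⌊θn⌋`, ≈ 90 lines)
  gives `Δ_N → r`, i.e. the crux BY NAME.

Neither stub alone gives the crux (Cesàro convergence allows `O(1)` oscillating increments; slow oscillation
allows `Δ_N → ∞` slowly), and the crux implies both (a convergent sequence is Cesàro-convergent and slowly
oscillating), so the seam loses nothing.

Disproof used: no `Cruxes/ParabolicGerm/Disproof.lean` exists (`ledger crux ls stmt-AtomisticToContinuum-11921`: no
workfiles before this one). Load-bearing hypotheses of the crux honoured: weak-NESS uniqueness, the steady family, the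
conductance hypothesis and BOTH antecedents (`G → 0`, `G > 0`) are carried verbatim by both stubs (the harmonic member,
barrier `HarmonicChainBallisticFlux`, violates `G → 0` and satisfies both stubs vacuously, as it satisfies the crux).
`ledger negatives --problem AtomisticToContinuum`: no refuted statement concerns resistance increments or `R_N/N`.
-/

noncomputable section

open Filter Topology Set MeasureTheory

namespace Summit.AtomisticToContinuum.FouriersLaw.Cruxes.ParabolicGerm.Birth

open Literature.MathematicalPhysics.KineticTheory.HeatConduction
open Summit.AtomisticToContinuum.FouriersLaw.Theses.ParabolicBathMap (ParabolicGerm)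

/-! ### The registered stubs (`sorry` lives ONLY here) -/

/-- STUB 1 `stub_resistanceSlope` (size L–XL) — **the orbit has an asymptotic resistance per site.** For
`P = pinnedChain ω₂ lam β γ` (all `> 0`), under weak-NESS uniqueness, for every `T > 0` there is one real `r` such
that along every steady-state family and every conductance sequence `G` (`N ≥ 2`), IF `G N → 0` and `G N > 0`
(`N ≥ 2`) THEN `R_N/N = (G N)⁻¹/N → r`. (`r ≥ 0` automatically; `r > 0` ⇔ Fourier with `κ = 1/r`; `r = 0` = anomalous
with a rate — NOT excluded here.) Why plausibly true: series composition makes `N ↦ R_N` quasi-subadditive (and, by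
the junction picture, quasi-superadditive up to contact terms), and Fekete's lemma gives the slope; it is also a
consequence of the conjunct itself. Discharge route foreseen: the shared import slot
`FeketeSeriesLaw.PositiveOrInfiniteLimit` (stmt-AtomisticToContinuum-9128, `D_N → ℓ ∈ (0,+∞]` in `EReal`) implies it
(`R_N/N = ((N-1)/N)·D_N⁻¹`, `EReal` inversion, and family-independence of `G N`, `N ≥ 2`, from uniqueness).
Why it might fail: `liminf R_N/N < limsup R_N/N` — the pinned chain alternating between transport regimes on
unboundedly long length scales (no mechanism known; excluded by any Fekete-type composition inequality).
[cite: BonettoLebowitzReyBellet2000, §5.3 eq. (33)] [cite: AokiKusnezov2000, eqs. (10)–(11)] -/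
theorem stub_resistanceSlope :
    ∀ ω₂ lam β γ : ℝ, 0 < ω₂ → 0 < lam → 0 < β → 0 < γ →
      (∀ (N : ℕ) (T_L T_R : ℝ), 0 < T_L → 0 < T_R → ∀ μ ν : Measure (PhaseSpace N),
          (pinnedChain ω₂ lam β γ).IsSteadyState N T_L T_R μ →
            (pinnedChain ω₂ lam β γ).IsSteadyState N T_L T_R ν → μ = ν) →
        ∀ T : ℝ, 0 < T → ∃ r : ℝ,
          ∀ μ : (N : ℕ) → ℝ → ℝ → Measure (PhaseSpace N),
            (∀ (N : ℕ) (T_L T_R : ℝ), 0 < T_L → 0 < T_R →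
                (pinnedChain ω₂ lam β γ).IsSteadyState N T_L T_R (μ N T_L T_R)) →
              ∀ G : ℕ → ℝ,
                (∀ N : ℕ, 2 ≤ N → Tendsto (fun δ : ℝ =>
                    (pinnedChain ω₂ lam β γ).totalCurrent (μ N (T + δ / 2) (T - δ / 2)) /
                      (((N : ℝ) - 1) * δ)) (nhdsWithin 0 {(0 : ℝ)}ᶜ) (nhds (G N))) →
                  Tendsto G atTop (nhds 0) → (∀ N : ℕ, 2 ≤ N → 0 < G N) →
                    Tendsto (fun N : ℕ => (G N)⁻¹ / (N : ℝ)) atTop (nhds r) := by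
  sorry

/-- STUB 2 `stub_slowOscillation` (size XL; the load-bearing stub) — **geometric-window screening: the resistance
increments are slowly oscillating.** For `P = pinnedChain ω₂ lam β γ` (all `> 0`), under weak-NESS uniqueness, for
every `T > 0`, every steady-state family and every conductance sequence `G` (`N ≥ 2`) with `G N → 0` and `G N > 0`
(`N ≥ 2`): for every `ε > 0` there are `θ > 0` and `N₀` such that
`|((G (m+1))⁻¹ - (G m)⁻¹) - ((G (n+1))⁻¹ - (G n)⁻¹)| ≤ ε` whenever `N₀ ≤ n ≤ m ≤ (1+θ)·n` (R. Schmidt's slow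
oscillation of `Δ_N = R_{N+1} - R_N`). Why plausibly true: the insertion resistance of one more standard site is
decided at the junction and screened by the long standard head behind it (the route's `JunctionLocality` gives the
far stronger Cauchy property `|Δ_m - Δ_n| ≤ 2ε` for ALL `m ≥ n ≥ N₀`); power-law or logarithmic finite-size
corrections (`D_N = κ - c N^{-1/2}`, Lee–Dadswell) keep `Δ` slowly oscillating. Why it might fail: a persistent `O(1)`
oscillation of `Δ_N` on a length scale `o(N)` — period-2 band-edge or contact resonances surviving at `T > 0` — the
crux's own named failure mode, isolated here from the existence of the slope.
[cite: BonettoLebowitzReyBellet2000, §7] [cite: LeeDadswell2015] [cite: Dhar2008, §3] -/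
theorem stub_slowOscillation :
    ∀ ω₂ lam β γ : ℝ, 0 < ω₂ → 0 < lam → 0 < β → 0 < γ →
      (∀ (N : ℕ) (T_L T_R : ℝ), 0 < T_L → 0 < T_R → ∀ μ ν : Measure (PhaseSpace N),
          (pinnedChain ω₂ lam β γ).IsSteadyState N T_L T_R μ →
            (pinnedChain ω₂ lam β γ).IsSteadyState N T_L T_R ν → μ = ν) →
        ∀ T : ℝ, 0 < T →
          ∀ μ : (N : ℕ) → ℝ → ℝ → Measure (PhaseSpace N),
            (∀ (N : ℕ) (T_L T_R : ℝ), 0 < T_L → 0 < T_R →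
                (pinnedChain ω₂ lam β γ).IsSteadyState N T_L T_R (μ N T_L T_R)) →
              ∀ G : ℕ → ℝ,
                (∀ N : ℕ, 2 ≤ N → Tendsto (fun δ : ℝ =>
                    (pinnedChain ω₂ lam β γ).totalCurrent (μ N (T + δ / 2) (T - δ / 2)) /
                      (((N : ℝ) - 1) * δ)) (nhdsWithin 0 {(0 : ℝ)}ᶜ) (nhds (G N))) →
                  Tendsto G atTop (nhds 0) → (∀ N : ℕ, 2 ≤ N → 0 < G N) →
                    ∀ ε : ℝ, 0 < ε → ∃ θ : ℝ, 0 < θ ∧ ∃ N₀ : ℕ, ∀ n : ℕ, N₀ ≤ n → ∀ m : ℕ, n ≤ m →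
                      (m : ℝ) ≤ (1 + θ) * n →
                        |((G (m + 1))⁻¹ - (G m)⁻¹) - ((G (n + 1))⁻¹ - (G n)⁻¹)| ≤ ε := by
  sorry

/-! ### By-name statements of the registered stubs

The skeleton audit (`#h21_check_skeleton`) wants the hypotheses of the crux-concluding theorem to be the declared
stubs BY NAME; `Registered.stub_x` is DEFINITIONALLY the statement of the sorried `theorem stub_x` (`type_of%`), so
`ParabolicGerm_of : Registered.stub_resistanceSlope → Registered.stub_slowOscillation → ParabolicGerm` is literally
"stub signatures → crux", and the `example` at the end type-checks `ParabolicGerm_of stub_resistanceSlope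
stub_slowOscillation : ParabolicGerm`. -/

namespace Registered

/-- Statement of registered stub 1 (`stub_resistanceSlope`), by name. -/
def stub_resistanceSlope : Prop := type_of% Birth.stub_resistanceSlope

/-- Statement of registered stub 2 (`stub_slowOscillation`), by name. -/
def stub_slowOscillation : Prop := type_of% Birth.stub_slowOscillation

end Registered

/-! ### The analytic seam (proved): Schmidt's Tauberian theorem, discrete slow-oscillation form -/

/-- **Cesàro convergence + slow oscillation ⇒ convergence** (R. Schmidt 1925; the window argument `H = [εN]` of
Montgomery–Vaughan's Theorem 5.6). If `(∑_{i<n} s i)/n → L` and for every `ε > 0` there are `θ > 0`, `N₀` with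
`|s m - s n| ≤ ε` whenever `N₀ ≤ n ≤ m ≤ (1+θ) n`, then `s n → L`. Proof: with `k = ⌊θn⌋`, `m = n + k`, the window
sum `∑_{n≤i<m} s i` is within `kε/3` of `k·s n` (slow oscillation) and within `η(m+n)` of `k·L` (Cesàro control
`|∑_{i<p} s i - pL| ≤ ηp` at `p = n, m`); divide by `k ≥ θn/2`. [cite: MontgomeryVaughan2007, Thm 5.6] -/
theorem tendsto_of_cesaro_of_slowlyOscillating {s : ℕ → ℝ} {L : ℝ}
    (hces : Tendsto (fun n : ℕ => (∑ i ∈ Finset.range n, s i) / (n : ℝ)) atTop (𝓝 L))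
    (hso : ∀ ε : ℝ, 0 < ε → ∃ θ : ℝ, 0 < θ ∧ ∃ N₀ : ℕ, ∀ n : ℕ, N₀ ≤ n → ∀ m : ℕ, n ≤ m →
      (m : ℝ) ≤ (1 + θ) * n → |s m - s n| ≤ ε) :
    Tendsto s atTop (𝓝 L) := by
  rw [Metric.tendsto_atTop]
  intro ε hε
  obtain ⟨θ, hθ, N₀, hN₀⟩ := hso (ε / 3) (by positivity)
  have hKpos : (0 : ℝ) < 4 / θ + 1 := by positivity
  obtain ⟨η, hηdef⟩ : ∃ η : ℝ, η = ε / 3 / (4 / θ + 1) := ⟨_, rfl⟩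
  have hη : 0 < η := by rw [hηdef]; positivity
  have hηK : η * (4 / θ + 1) = ε / 3 := by
    rw [hηdef]; field_simp
  obtain ⟨N₁, hN₁⟩ := Metric.tendsto_atTop.1 hces η hη
  refine ⟨max (max N₀ N₁) (max 1 ⌈2 / θ⌉₊), fun n hn => ?_⟩
  have hn₀ : N₀ ≤ n := le_trans (le_trans (le_max_left _ _) (le_max_left _ _)) hn
  have hn₁ : N₁ ≤ n := le_trans (le_trans (le_max_right _ _) (le_max_left _ _)) hn
  have hn1 : 1 ≤ n := le_trans (le_trans (le_max_left _ _) (le_max_right _ _)) hn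
  have hnc : ⌈2 / θ⌉₊ ≤ n := le_trans (le_trans (le_max_right _ _) (le_max_right _ _)) hn
  have hnpos : (0 : ℝ) < n := by exact_mod_cast hn1
  have hθn : 2 ≤ θ * n := by
    have h1 : 2 / θ ≤ (n : ℝ) := le_trans (Nat.le_ceil _) (by exact_mod_cast hnc)
    have h2 : θ * (2 / θ) = 2 := by field_simp
    calc (2 : ℝ) = θ * (2 / θ) := h2.symm
      _ ≤ θ * n := mul_le_mul_of_nonneg_left h1 hθ.le
  -- window length k = ⌊θ n⌋₊, right end m = n + k
  obtain ⟨k, hk⟩ : ∃ k : ℕ, k = ⌊θ * n⌋₊ := ⟨_, rfl⟩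
  have hk_le : (k : ℝ) ≤ θ * n := by rw [hk]; exact Nat.floor_le (by positivity)
  have hk_gt : θ * n < (k : ℝ) + 1 := by rw [hk]; exact Nat.lt_floor_add_one _
  have hkpos : (0 : ℝ) < k := by linarith
  have hk2 : θ * n ≤ 2 * k := by linarith
  obtain ⟨m, hm⟩ : ∃ m : ℕ, m = n + k := ⟨_, rfl⟩
  have hmcast : (m : ℝ) = n + k := by rw [hm]; push_cast; ring
  have hnm : n ≤ m := by rw [hm]; exact Nat.le_add_right _ _
  have hm₁ : N₁ ≤ m := le_trans hn₁ hnm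
  have hmpos : (0 : ℝ) < m := by rw [hmcast]; linarith
  -- (a) slow oscillation across the window
  have hwin : ∀ j ∈ Finset.range k, |s (n + j) - s n| ≤ ε / 3 := by
    intro j hj
    have hj : (j : ℝ) < k := by exact_mod_cast Finset.mem_range.1 hj
    refine hN₀ n hn₀ (n + j) (Nat.le_add_right _ _) ?_
    push_cast
    linarith
  have hA : |∑ j ∈ Finset.range k, s (n + j) - k * s n| ≤ k * (ε / 3) := by
    have e : ∑ j ∈ Finset.range k, s (n + j) - k * s n = ∑ j ∈ Finset.range k, (s (n + j) - s n) := by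
      rw [Finset.sum_sub_distrib, Finset.sum_const, Finset.card_range, nsmul_eq_mul]
    rw [e]
    calc |∑ j ∈ Finset.range k, (s (n + j) - s n)|
        ≤ ∑ j ∈ Finset.range k, |s (n + j) - s n| := Finset.abs_sum_le_sum_abs _ _
      _ ≤ ∑ j ∈ Finset.range k, (ε / 3 : ℝ) := Finset.sum_le_sum hwin
      _ = k * (ε / 3) := by rw [Finset.sum_const, Finset.card_range, nsmul_eq_mul]
  -- (b) the window sum is a difference of partial sums
  have hsum : ∑ i ∈ Finset.range m, s i - ∑ i ∈ Finset.range n, s i =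
      ∑ j ∈ Finset.range k, s (n + j) := by
    rw [hm, Finset.sum_range_add]; ring
  -- (c) Cesàro control of the partial sums at n and at m
  have hC : ∀ p : ℕ, N₁ ≤ p → (0 : ℝ) < p → |∑ i ∈ Finset.range p, s i - p * L| ≤ η * p := by
    intro p hp hp0
    have h := hN₁ p hp
    rw [Real.dist_eq] at h
    have e : ∑ i ∈ Finset.range p, s i - p * L = ((∑ i ∈ Finset.range p, s i) / p - L) * p := by
      field_simp
    rw [e, abs_mul, abs_of_pos hp0]
    exact mul_le_mul_of_nonneg_right h.le hp0.le
  have hCn := hC n hn₁ hnpos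
  have hCm := hC m hm₁ hmpos
  -- (d) combine: k |s n - L| ≤ k ε/3 + η (m + n)
  have hmain : (k : ℝ) * |s n - L| ≤ k * (ε / 3) + η * (m + n) := by
    have e : (k : ℝ) * (s n - L) = (k * s n - ∑ j ∈ Finset.range k, s (n + j)) +
        ((∑ i ∈ Finset.range m, s i - m * L) - (∑ i ∈ Finset.range n, s i - n * L)) := by
      rw [← hsum, hmcast]; ring
    calc (k : ℝ) * |s n - L| = |(k : ℝ) * (s n - L)| := by rw [abs_mul, abs_of_pos hkpos]
      _ = |(k * s n - ∑ j ∈ Finset.range k, s (n + j)) +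
            ((∑ i ∈ Finset.range m, s i - m * L) - (∑ i ∈ Finset.range n, s i - n * L))| := by rw [e]
      _ ≤ |k * s n - ∑ j ∈ Finset.range k, s (n + j)| +
            |(∑ i ∈ Finset.range m, s i - m * L) - (∑ i ∈ Finset.range n, s i - n * L)| := abs_add_le _ _
      _ ≤ |k * s n - ∑ j ∈ Finset.range k, s (n + j)| +
            (|∑ i ∈ Finset.range m, s i - m * L| + |∑ i ∈ Finset.range n, s i - n * L|) :=
          add_le_add le_rfl (abs_sub _ _)
      _ ≤ k * (ε / 3) + (η * m + η * n) :=
          add_le_add (by rw [abs_sub_comm]; exact hA) (add_le_add hCm hCn)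
      _ = k * (ε / 3) + η * (m + n) := by ring
  -- (e) divide by k, using (m + n)/k = (2n + k)/k ≤ 4/θ + 1
  have hratio : η * ((m : ℝ) + n) ≤ k * (η * (4 / θ + 1)) := by
    rw [hmcast]
    have h2θ : (0 : ℝ) ≤ 2 / θ := by positivity
    have hid : 4 / θ * k - 2 * n = (2 / θ) * (2 * k - θ * n) := by
      field_simp
      ring
    have h4 : 2 * (n : ℝ) ≤ 4 / θ * k := by
      have := mul_nonneg h2θ (sub_nonneg.2 hk2)
      linarith
    calc η * ((n : ℝ) + k + n) = η * (2 * n + k) := by ring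
      _ ≤ η * (4 / θ * k + k) := by gcongr
      _ = k * (η * (4 / θ + 1)) := by ring
  have hfin : (k : ℝ) * |s n - L| ≤ k * (2 * ε / 3) := by
    calc (k : ℝ) * |s n - L| ≤ k * (ε / 3) + η * (m + n) := hmain
      _ ≤ k * (ε / 3) + k * (η * (4 / θ + 1)) := by linarith [hratio]
      _ = k * (ε / 3) + k * (ε / 3) := by rw [hηK]
      _ = k * (2 * ε / 3) := by ring
  have hend : |s n - L| ≤ 2 * ε / 3 := le_of_mul_le_mul_left hfin hkpos
  rw [Real.dist_eq]
  linarith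

/-! ### The composition (kernel-checked, no `sorry`): the two stubs give the crux BY NAME -/

/-- `stub_resistanceSlope → stub_slowOscillation → ParabolicGerm`. Take `r` from stub 1 (its `∃ r ∀ family` is the
crux's); for a steady family `μ` and a conductance sequence `G` with `G → 0`, `G > 0` (`N ≥ 2`), telescoping
(`Finset.sum_range_sub`) gives `(∑_{i<n} Δ_i)/n = R_n/n - R_0/n` with `R_N := (G N)⁻¹`, `Δ_i := R_{i+1} - R_i`, so
stub 1 is Cesàro convergence of `Δ` to `r` (`R_0/n → 0`); stub 2 is slow oscillation of `Δ`; the Tauberian theorem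
`tendsto_of_cesaro_of_slowlyOscillating` gives `Δ_N → r`, which is the crux BY NAME. [folklore] -/
theorem ParabolicGerm_of (h1 : Registered.stub_resistanceSlope) (h2 : Registered.stub_slowOscillation) :
    ParabolicGerm := by
  intro ω₂ lam β γ hω hl hβ hγ hU T hT
  obtain ⟨r, hr⟩ := h1 ω₂ lam β γ hω hl hβ hγ hU T hT
  refine ⟨r, fun μ hμ G hG h0 hpos => ?_⟩
  -- stub 1: the resistance per site R_N/N tends to r
  have hslope : Tendsto (fun N : ℕ => (G N)⁻¹ / (N : ℝ)) atTop (𝓝 r) := hr μ hμ G hG h0 hpos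
  -- stub 2: the increments are slowly oscillating
  have hso := h2 ω₂ lam β γ hω hl hβ hγ hU T hT μ hμ G hG h0 hpos
  refine tendsto_of_cesaro_of_slowlyOscillating (s := fun N : ℕ => (G (N + 1))⁻¹ - (G N)⁻¹) ?_ hso
  -- Cesàro means of the increments: (∑_{i<n} Δ_i)/n = R_n/n - R_0/n → r - 0
  have hsum : ∀ n : ℕ, ∑ i ∈ Finset.range n, ((G (i + 1))⁻¹ - (G i)⁻¹) = (G n)⁻¹ - (G 0)⁻¹ :=
    fun n => Finset.sum_range_sub (fun i => (G i)⁻¹) n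
  have h0' : Tendsto (fun n : ℕ => (G 0)⁻¹ / (n : ℝ)) atTop (𝓝 0) := by
    simpa [div_eq_mul_inv] using (tendsto_inv_atTop_nhds_zero_nat (𝕜 := ℝ)).const_mul ((G 0)⁻¹)
  have hlim := hslope.sub h0'
  rw [sub_zero] at hlim
  refine hlim.congr (fun n => ?_)
  show (G n)⁻¹ / (n : ℝ) - (G 0)⁻¹ / (n : ℝ) = (∑ i ∈ Finset.range n, ((G (i + 1))⁻¹ - (G i)⁻¹)) / (n : ℝ)
  rw [hsum, sub_div]

/-- Type-check (not a declaration): the sorried stubs are literally the antecedents of `ParabolicGerm_of`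
(conditional on the stubs; an `example`, so it adds nothing to the environment). -/
example : ParabolicGerm := ParabolicGerm_of stub_resistanceSlope stub_slowOscillation

end Summit.AtomisticToContinuum.FouriersLaw.Cruxes.ParabolicGerm.Birth

end
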